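import Summits.Ventures.PercRepro.ThetaOmegaGraphSymm
import Summits.Ventures.PercRepro.ThetaOmegaGraphMono

/-!
# The graph form of (Ω): slot meets, triple packings, and the full family

Addendum 85 (mine-1, gen 46). In the complement-closed reading of Addendum 84 every counted set
of the graph count `omegaCountG Γ U F` is the MEET of two `Γ`-related slots: the meet of two first
slots, the difference of a first and a second slot, the marked co-join of two second slots. This
file records that reading and two consequences:

* `slotMeet U u v` — the meet of two slots, a set with a marker (`true` = a co-join, which lives
  in the `C`-family; `false` = an `A`-set); `omegaSetG Γ U F` — the counted sets with their
  markers, of cardinality `omegaCountG Γ U F` (`card_omegaSetG`); `slotMeet_mem_omegaSetG` —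
  the meet of two distinct `Γ`-related slots of `F` is counted;
* `card_le_omegaCountG_of_packing` — **the packing bound**: a family of triples of distinct slots
  of `F` whose meet-sets (`tripleMeets`) are pairwise disjoint has at most `omegaCountG Γ U F`
  members, for EVERY symmetric graph `Γ` of independence number ≤ 2 on the slots of `F` (each
  triple contains a `Γ`-edge, whose meet is counted, and distinct triples give distinct meets).
  So a packing of `|F|` such triples is a certificate of the bound of (Ω_Γ) for `F` on `U`;
* `card_le_omegaCountG_powerset` — **(Ω_Γ) for the full family** `F = U.powerset` on every ground
  set with at least two points: every `m ⊊ U` is the meet of all three pairs of the slots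
  `(m, ⊤)`, `(m + x, ⊤)`, `(U \ m, ⊥)` (`x ∈ U \ m`), and the marked `∅` is the co-join of all
  three pairs of `(U, ⊥)`, `(U.erase x, ⊥)`, `(U.erase y, ⊥)` — `2 ^ |U|` pairwise disjoint
  singleton meet-sets.
-/

namespace PercRepro.MSTight

open Finset

variable {α : Type*} [DecidableEq α]

section SlotMeet

/-- **The meet of two slots**: first–first = the meet of the members, first–second = the
difference, second–second = the co-join relative to `U`, marked `true`. -/
def slotMeet (U : Finset α) (u v : Slot α) : Finset α × Bool :=
  match u.2, v.2 with
  | false, false => (u.1 ⊓ v.1, false)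
  | false, true => (u.1 \ v.1, false)
  | true, false => (v.1 \ u.1, false)
  | true, true => (U \ (u.1 ⊔ v.1), true)

/-- Two first slots meet in the meet of the members. -/
theorem slotMeet_top_top (U : Finset α) (s t : Finset α) :
    slotMeet U (topSlot s) (topSlot t) = (s ⊓ t, false) := rfl

/-- A first and a second slot meet in the difference. -/
theorem slotMeet_top_bot (U : Finset α) (s t : Finset α) :
    slotMeet U (topSlot s) (botSlot t) = (s \ t, false) := rfl

/-- A second and a first slot meet in the difference of the latter by the former. -/
theorem slotMeet_bot_top (U : Finset α) (s t : Finset α) :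
    slotMeet U (botSlot s) (topSlot t) = (t \ s, false) := rfl

/-- Two second slots meet in the marked co-join. -/
theorem slotMeet_bot_bot (U : Finset α) (s t : Finset α) :
    slotMeet U (botSlot s) (botSlot t) = (U \ (s ⊔ t), true) := rfl

variable {Γ : Slot α → Slot α → Prop} [DecidableRel Γ] {U : Finset α} {F : Finset (Finset α)}

/-- The counted sets of the graph count with their markers: the `A`-sets marked `false`, the
co-joins marked `true`. -/
def omegaSetG (Γ : Slot α → Slot α → Prop) [DecidableRel Γ] (U : Finset α)
    (F : Finset (Finset α)) : Finset (Finset α × Bool) :=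
  (omegaAR Γ F topSlot botSlot).map ⟨fun E => (E, false), fun _ _ h => congrArg Prod.fst h⟩ ∪
    (omegaCR Γ U F botSlot).map ⟨fun E => (E, true), fun _ _ h => congrArg Prod.fst h⟩

/-- The marked counted sets number exactly the graph count. -/
theorem card_omegaSetG : (omegaSetG Γ U F).card = omegaCountG Γ U F := by
  unfold omegaSetG omegaCountG omegaCountR
  rw [card_union_of_disjoint, card_map, card_map]
  rw [disjoint_left]
  intro x hx hx'
  simp only [mem_map, Function.Embedding.coeFn_mk] at hx hx'
  obtain ⟨a, _, rfl⟩ := hx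
  obtain ⟨b, _, hb⟩ := hx'
  exact Bool.false_ne_true (congrArg Prod.snd hb).symm

/-- **The meet of two distinct related slots of `F` is counted.** -/
theorem slotMeet_mem_omegaSetG (hsym : ∀ u v, Γ u v → Γ v u) {u v : Slot α} (hu : u.1 ∈ F)
    (hv : v.1 ∈ F) (huv : u ≠ v) (h : Γ u v) : slotMeet U u v ∈ omegaSetG Γ U F := by
  obtain ⟨s, b⟩ := u
  obtain ⟨t, c⟩ := v
  simp only at hu hv
  unfold omegaSetG
  simp only [mem_union, mem_map, Function.Embedding.coeFn_mk]
  cases b <;> cases c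
  · -- first–first: a meet of distinct members
    have hst : s ≠ t := fun hst => huv (by rw [hst])
    refine Or.inl ⟨s ⊓ t, mem_omegaAR.2 (Or.inl ⟨s, hu, t, hv, hst, h, rfl⟩), rfl⟩
  · -- first–second: a difference
    exact Or.inl ⟨s \ t, mem_omegaAR.2 (Or.inr ⟨s, hu, t, hv, h, rfl⟩), rfl⟩
  · -- second–first: the difference in the other orientation (symmetry of `Γ`)
    exact Or.inl ⟨t \ s, mem_omegaAR.2 (Or.inr ⟨t, hv, s, hu, hsym _ _ h, rfl⟩), rfl⟩
  · -- second–second: a co-join of distinct members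
    have hst : s ≠ t := fun hst => huv (by rw [hst])
    exact Or.inr ⟨U \ (s ⊔ t), mem_omegaCR.2 ⟨s, hu, t, hv, hst, h, rfl⟩, rfl⟩

end SlotMeet

section Packing

variable {Γ : Slot α → Slot α → Prop} [DecidableRel Γ] {U : Finset α} {F : Finset (Finset α)}

/-- **The meet-set of a set of slots**: the meets of its ordered pairs of distinct slots. -/
def tripleMeets (U : Finset α) (T : Finset (Slot α)) : Finset (Finset α × Bool) :=
  T.offDiag.image fun p => slotMeet U p.1 p.2

omit [DecidableRel Γ] in
/-- Among three distinct slots of `F` some ordered pair is related, for a graph of independence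
number at most two. -/
theorem exists_rel_of_card_eq_three (hT : SlotTripleRel Γ F) {T : Finset (Slot α)}
    (h3 : T.card = 3) (hF : ∀ u ∈ T, u.1 ∈ F) : ∃ u ∈ T, ∃ v ∈ T, u ≠ v ∧ Γ u v := by
  obtain ⟨x, y, z, hxy, hxz, hyz, rfl⟩ := card_eq_three.1 h3
  have hx : x ∈ ({x, y, z} : Finset (Slot α)) := by simp
  have hy : y ∈ ({x, y, z} : Finset (Slot α)) := by simp
  have hz : z ∈ ({x, y, z} : Finset (Slot α)) := by simp
  rcases hT x y z (hF x hx) (hF y hy) (hF z hz) hxy hxz hyz with h | h | h | h | h | h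
  · exact ⟨x, hx, y, hy, hxy, h⟩
  · exact ⟨y, hy, x, hx, hxy.symm, h⟩
  · exact ⟨x, hx, z, hz, hxz, h⟩
  · exact ⟨z, hz, x, hx, hxz.symm, h⟩
  · exact ⟨y, hy, z, hz, hyz, h⟩
  · exact ⟨z, hz, y, hy, hyz.symm, h⟩

/-- **The packing bound**: a family of triples of distinct slots of `F` with pairwise disjoint
meet-sets has at most `omegaCountG Γ U F` members, for every symmetric graph `Γ` of independence
number at most two on the slots of `F`. -/
theorem card_le_omegaCountG_of_packing (hsym : ∀ u v, Γ u v → Γ v u) (hT : SlotTripleRel Γ F)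
    {ι : Type*} (P : Finset ι) (T : ι → Finset (Slot α)) (h3 : ∀ i ∈ P, (T i).card = 3)
    (hF : ∀ i ∈ P, ∀ u ∈ T i, u.1 ∈ F)
    (hdisj : ∀ i ∈ P, ∀ j ∈ P, i ≠ j → Disjoint (tripleMeets U (T i)) (tripleMeets U (T j))) :
    P.card ≤ omegaCountG Γ U F := by
  classical
  -- choose a related ordered pair in every triple
  have hsel : ∀ i ∈ P, ∃ p : Slot α × Slot α, p.1 ∈ T i ∧ p.2 ∈ T i ∧ p.1 ≠ p.2 ∧ Γ p.1 p.2 := by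
    intro i hi
    obtain ⟨u, hu, v, hv, huv, h⟩ := exists_rel_of_card_eq_three hT (h3 i hi) (hF i hi)
    exact ⟨(u, v), hu, hv, huv, h⟩
  choose! sel hsel using hsel
  let m : ι → Finset α × Bool := fun i => slotMeet U (sel i).1 (sel i).2
  have hmem : ∀ i ∈ P, m i ∈ tripleMeets U (T i) := by
    intro i hi
    obtain ⟨h1, h2, h3', _⟩ := hsel i hi
    exact mem_image.2 ⟨sel i, mem_offDiag.2 ⟨h1, h2, h3'⟩, rfl⟩
  rw [← card_omegaSetG]
  refine card_le_card_of_injOn m ?_ ?_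
  · intro i hi
    obtain ⟨h1, h2, h3', h4⟩ := hsel i hi
    exact slotMeet_mem_omegaSetG hsym (hF i hi _ h1) (hF i hi _ h2) h3' h4
  · intro i hi j hj hij
    by_contra hne
    have := disjoint_left.1 (hdisj i hi j hj hne) (hmem i hi)
    exact this (hij ▸ hmem j hj)

end Packing

section Powerset

variable {Γ : Slot α → Slot α → Prop} [DecidableRel Γ] {U : Finset α}

/-- The triple witnessing the `A`-set `m ⊊ U`: the first slots of `m` and `m + x` and the second
slot of `U \ m`, for a point `x ∈ U \ m`. -/
def powTriple (U m : Finset α) (x : α) : Finset (Slot α) :=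
  {topSlot m, topSlot (insert x m), botSlot (U \ m)}

/-- The triple witnessing the marked `∅`: the second slots of `U`, `U.erase x`, `U.erase y`. -/
def powTripleC (U : Finset α) (x y : α) : Finset (Slot α) :=
  {botSlot U, botSlot (U.erase x), botSlot (U.erase y)}

/-- The triple of `m ⊊ U` consists of three distinct slots. -/
theorem powTriple_card {m : Finset α} {x : α} (hx : x ∈ U \ m) :
    (powTriple U m x).card = 3 := by
  have hxm : x ∉ m := (mem_sdiff.1 hx).2
  rw [card_eq_three]
  refine ⟨topSlot m, topSlot (insert x m), botSlot (U \ m), ?_, topSlot_ne_botSlot _ _,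
    topSlot_ne_botSlot _ _, rfl⟩
  intro h
  have := topSlot_injective h
  exact hxm (this ▸ mem_insert_self x m)

/-- The marked triple consists of three distinct slots. -/
theorem powTripleC_card {x y : α} (hx : x ∈ U) (hy : y ∈ U) (hxy : x ≠ y) :
    (powTripleC U x y).card = 3 := by
  rw [card_eq_three]
  refine ⟨botSlot U, botSlot (U.erase x), botSlot (U.erase y), ?_, ?_, ?_, rfl⟩
  · intro h
    have := botSlot_injective h
    exact (notMem_erase x U) (this ▸ hx)
  · intro h
    have := botSlot_injective h
    exact (notMem_erase y U) (this ▸ hy)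
  · intro h
    have := botSlot_injective h
    have hx' : x ∈ U.erase y := mem_erase.2 ⟨hxy, hx⟩
    exact (notMem_erase x U) (this ▸ hx')

/-- Every meet of the triple of `m` is the `A`-set `m`. -/
theorem tripleMeets_powTriple_subset {m : Finset α} {x : α} (hx : x ∈ U \ m) :
    tripleMeets U (powTriple U m x) ⊆ {(m, false)} := by
  have hxU : x ∈ U := (mem_sdiff.1 hx).1
  have hxm : x ∉ m := (mem_sdiff.1 hx).2
  intro E hE
  obtain ⟨⟨u, v⟩, huv, rfl⟩ := mem_image.1 hE
  obtain ⟨hu, hv, hne⟩ := mem_offDiag.1 huv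
  simp only [powTriple, mem_insert, mem_singleton] at hu hv
  rw [mem_singleton]
  have e1 : m ⊓ insert x m = m := inf_eq_left.2 (subset_insert x m)
  have e2 : m \ (U \ m) = m := sdiff_eq_self_iff_disjoint.2 (disjoint_sdiff.symm)
  have e3 : insert x m \ (U \ m) = m := by
    ext a
    simp only [mem_sdiff, mem_insert, not_and, not_not]
    constructor
    · rintro ⟨ha | ha, h⟩
      · subst ha; exact absurd (h hxU) hxm
      · exact ha
    · intro ha; exact ⟨Or.inr ha, fun _ => ha⟩
  rcases hu with rfl | rfl | rfl <;> rcases hv with rfl | rfl | rfl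
  · exact absurd rfl hne
  · rw [slotMeet_top_top, e1]
  · rw [slotMeet_top_bot, e2]
  · rw [slotMeet_top_top, inf_comm, e1]
  · exact absurd rfl hne
  · rw [slotMeet_top_bot, e3]
  · rw [slotMeet_bot_top, e2]
  · rw [slotMeet_bot_top, e3]
  · exact absurd rfl hne

/-- Every meet of the marked triple is the marked `∅`. -/
theorem tripleMeets_powTripleC_subset {x y : α} (hx : x ∈ U) (hxy : x ≠ y) :
    tripleMeets U (powTripleC U x y) ⊆ {(∅, true)} := by
  intro E hE
  obtain ⟨⟨u, v⟩, huv, rfl⟩ := mem_image.1 hE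
  obtain ⟨hu, hv, hne⟩ := mem_offDiag.1 huv
  simp only [powTripleC, mem_insert, mem_singleton] at hu hv
  rw [mem_singleton]
  have ex : U.erase x ⊆ U := erase_subset x U
  have ey : U.erase y ⊆ U := erase_subset y U
  have e1 : U \ (U ⊔ U.erase x) = ∅ := by rw [sup_eq_left.2 ex, sdiff_self]; rfl
  have e2 : U \ (U ⊔ U.erase y) = ∅ := by rw [sup_eq_left.2 ey, sdiff_self]; rfl
  have e3 : U \ (U.erase x ⊔ U.erase y) = ∅ := by
    rw [sdiff_eq_empty_iff_subset]
    intro a ha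
    rw [sup_eq_union, mem_union, mem_erase, mem_erase]
    by_cases hax : a = x
    · subst hax
      exact Or.inr ⟨hxy, ha⟩
    · exact Or.inl ⟨hax, ha⟩
  rcases hu with rfl | rfl | rfl <;> rcases hv with rfl | rfl | rfl
  · exact absurd rfl hne
  · rw [slotMeet_bot_bot, e1]
  · rw [slotMeet_bot_bot, e2]
  · rw [slotMeet_bot_bot, sup_comm, e1]
  · exact absurd rfl hne
  · rw [slotMeet_bot_bot, e3]
  · rw [slotMeet_bot_bot, sup_comm, e2]
  · rw [slotMeet_bot_bot, sup_comm, e3]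
  · exact absurd rfl hne

/-- A point of `U` outside `m`, when there is one (else the default `x₀`). -/
noncomputable def pickOut (U m : Finset α) (x₀ : α) : α :=
  if h : (U \ m).Nonempty then h.choose else x₀

/-- The chosen point lies in `U \ m` when `U \ m` is nonempty. -/
theorem pickOut_mem {m : Finset α} (x₀ : α) (h : (U \ m).Nonempty) : pickOut U m x₀ ∈ U \ m := by
  unfold pickOut
  rw [dif_pos h]
  exact h.choose_spec

/-- The index of the forced meets of the full family: the `A`-sets `m ⊊ U` and the marked `∅`. -/
def powIndex (U : Finset α) : Finset (Finset α × Bool) :=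
  (U.powerset.erase U).map ⟨fun m => (m, false), fun _ _ h => congrArg Prod.fst h⟩ ∪ {(∅, true)}

/-- Membership in the index of forced meets. -/
theorem mem_powIndex {i : Finset α × Bool} :
    i ∈ powIndex U ↔ (i.1 ∈ U.powerset.erase U ∧ i.2 = false) ∨ i = (∅, true) := by
  unfold powIndex
  simp only [mem_union, mem_map, Function.Embedding.coeFn_mk, mem_singleton]
  constructor
  · rintro (⟨m, hm, rfl⟩ | rfl)
    · exact Or.inl ⟨hm, rfl⟩
    · exact Or.inr rfl
  · rintro (⟨hm, h2⟩ | rfl)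
    · exact Or.inl ⟨i.1, hm, Prod.ext rfl h2.symm⟩
    · exact Or.inr rfl

/-- The forced meets number `2 ^ |U|`. -/
theorem card_powIndex : (powIndex U).card = U.powerset.card := by
  unfold powIndex
  have hU : U ∈ U.powerset := mem_powerset.2 (Subset.refl U)
  rw [card_union_of_disjoint, card_map, card_singleton, card_erase_of_mem hU]
  · have : 1 ≤ U.powerset.card := card_pos.2 ⟨U, hU⟩
    omega
  · rw [disjoint_singleton_right, mem_map]
    rintro ⟨m, _, h⟩
    exact Bool.false_ne_true (congrArg Prod.snd h)

/-- The witnessing triples of the full family, indexed by the forced meets. -/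
noncomputable def powTriples (U : Finset α) (x₀ y₀ : α) (i : Finset α × Bool) : Finset (Slot α) :=
  bif i.2 then powTripleC U x₀ y₀ else powTriple U i.1 (pickOut U i.1 x₀)

/-- The triple of an `A`-index. -/
theorem powTriples_of_false {x₀ y₀ : α} {i : Finset α × Bool} (h : i.2 = false) :
    powTriples U x₀ y₀ i = powTriple U i.1 (pickOut U i.1 x₀) := by
  unfold powTriples
  rw [h]
  rfl

/-- The triple of the marked index. -/
theorem powTriples_of_true {x₀ y₀ : α} {i : Finset α × Bool} (h : i.2 = true) :
    powTriples U x₀ y₀ i = powTripleC U x₀ y₀ := by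
  unfold powTriples
  rw [h]
  rfl

/-- A proper subset of `U` leaves a point of `U` uncovered. -/
theorem sdiff_nonempty_of_mem_erase {m : Finset α} (hm : m ∈ U.powerset.erase U) :
    (U \ m).Nonempty := by
  rw [mem_erase, mem_powerset] at hm
  rw [sdiff_nonempty]
  intro hUm
  exact hm.1 (Subset.antisymm hm.2 hUm)

/-- **(Ω_Γ) for the full family**: on a ground set with at least two points, the family of ALL
subsets has at least `2 ^ |U|` edge-meets for every symmetric graph of independence number at
most two on its slots — the `2 ^ |U|` forced meets `(m, ⊤)` (`m ⊊ U`) and the marked `∅`. -/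
theorem card_le_omegaCountG_powerset (hsym : ∀ u v, Γ u v → Γ v u)
    (hT : SlotTripleRel Γ U.powerset) (hU : 2 ≤ U.card) :
    U.powerset.card ≤ omegaCountG Γ U U.powerset := by
  obtain ⟨x₀, y₀, hx₀, hy₀, hne⟩ := one_lt_card_iff.1 (by omega : 1 < U.card)
  rw [← card_powIndex]
  refine card_le_omegaCountG_of_packing hsym hT (powIndex U) (powTriples U x₀ y₀) ?_ ?_ ?_
  · intro i hi
    rcases mem_powIndex.1 hi with ⟨hm, h2⟩ | rfl
    · rw [powTriples_of_false h2]
      exact powTriple_card (pickOut_mem x₀ (sdiff_nonempty_of_mem_erase hm))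
    · rw [powTriples_of_true rfl]
      exact powTripleC_card hx₀ hy₀ hne
  · intro i hi u hu
    rcases mem_powIndex.1 hi with ⟨hm, h2⟩ | rfl
    · rw [powTriples_of_false h2] at hu
      have hmU : i.1 ⊆ U := mem_powerset.1 (mem_of_mem_erase hm)
      have hx := pickOut_mem x₀ (sdiff_nonempty_of_mem_erase hm)
      simp only [powTriple, mem_insert, mem_singleton] at hu
      rw [mem_powerset]
      rcases hu with rfl | rfl | rfl
      · exact hmU
      · exact insert_subset (mem_sdiff.1 hx).1 hmU
      · exact sdiff_subset
    · rw [powTriples_of_true rfl] at hu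
      simp only [powTripleC, mem_insert, mem_singleton] at hu
      rw [mem_powerset]
      rcases hu with rfl | rfl | rfl
      · exact Subset.refl U
      · exact erase_subset _ _
      · exact erase_subset _ _
  · intro i hi j hj hij
    have key : ∀ k ∈ powIndex U, tripleMeets U (powTriples U x₀ y₀ k) ⊆ {k} := by
      intro k hk
      rcases mem_powIndex.1 hk with ⟨hm, h2⟩ | rfl
      · rw [powTriples_of_false h2]
        have := tripleMeets_powTriple_subset (pickOut_mem x₀ (sdiff_nonempty_of_mem_erase hm))
        rwa [show ((k.1, false) : Finset α × Bool) = k from Prod.ext rfl h2.symm] at this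
      · rw [powTriples_of_true rfl]
        exact tripleMeets_powTripleC_subset hx₀ hne
    exact disjoint_of_subset_left (key i hi) (disjoint_of_subset_right (key j hj)
      (disjoint_singleton.2 hij))

end Powerset

end PercRepro.MSTight
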